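/-
Copyright: the b2b-balaban cell (near-miss cell 7), T⁴-continuum CRUX team (coordinator ruling e34b3e0c item (2)),
seat t4-ne7b-formalise-leaf-06 (gen 27). Released under the licence of the surrounding project.
-/
import Summits.QuantumFields.BalabanUV.T4Continuum.Spine.NE7b.AbelianCurvatureMaximumPrinciple

/-!
# The barrier lemma for lattice subsolutions: an approximate maximum principle with a source term
# (route NE7b R-H, `t4/ROUTES-NE7b.md` v5 §2 PH-k (γ) ∕ §3 (T-k1))

Cell `pub-balaban`, sub-cell `t4`, spine estimate NE7b (node U5c), candidate route R-H «Peierls healing map». ROUTES-NE7b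
v5 (seat `t4-ne7b-idea-1` gen 5) proposes PH-k, a discrete Bochner–Weitzenböck barrier for the interior-free `SU(2)`
minimiser, as candidate proof of the refuter's residual lemma (MP<L²). Its step (γ) is pure finite combinatorics on
functions `ℤ^d → ℝ` and is offered as kernel item (T-k1), «sequel for leaf-06» (this lineage's
`…NE7b.AbelianCurvatureMaximumPrinciple` = (T-k0) is the source-free, harmonic case):

  (γ) «if `2d·s(x) ≤ Σ_{λ,±} s(x ± e_λ) + κ` on a finite `I`, then `w := s + (κ∕2d)|x − x₀|²` is discrete-subharmonic on `I`
  (`Δ|x − x₀|² = 2d` exactly), so `s(x₀) = w(x₀) ≤ max_{∂I} w ≤ max_{∂I} s + (κ∕2d)·max_{∂I}|x − x₀|²`.»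

THIS FILE PROVES (γ) on `ℤ^d`, every `d ≥ 1`:
* `distSq x₀ x = Σ_λ (x_λ − x₀_λ)²` and **`laplacian_distSq`**: `Σ_λ (distSq(x+e_λ) + distSq(x−e_λ)) = 2d·distSq(x) + 2d`;
* **`exists_mem_layer_le_of_subharmonic`** — the maximum principle for lattice SUBharmonic functions
  (`2d·f(x) ≤ Σ_{λ,±} f(x ± e_λ)` on a finite `I` ⇒ every value on `I` is `≤` a value on `layer I`; maximiser + walk along
  `e₀`, as in (T-k0));
* **`barrier_subsolution`** — (γ) verbatim and sign-free: `2d·s(x) ≤ Σ_{λ,±} s(x±e_λ) + κ` on `I` ⇒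
  `∀ x₀ ∈ I, ∃ y ∈ layer I, s(x₀) ≤ s(y) + (κ∕2d)·distSq x₀ y` (no sign condition on `κ`);
* **`barrier_subsolution_le`** — the NET form: with `κ ≥ 0`, `s ≤ M` on `layer I` and `distSq x₀ y ≤ D²` for `y ∈ layer I`,
  `s(x₀) ≤ M + (κ∕2d)·D²`; **`barrier_subsolution_le_of_source`** — the same for an `x`-dependent source `g ≤ κ` on `I`
  (the shape of PH-k (β₄)'s `C′_d·m_p²`).

HONEST FRAMING. Law-free lattice combinatorics; it says nothing about (β₁)–(β₄) (the SU(2) mean-value inequality with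
defect, [NEW-local], under refuter pricing), nothing about (MP<L²), nothing of [Bałaban 1983–89]. PH-c⁺ OPEN. NE7b
(`T4WeightBudget.RelWeightBound`) NOT PRINTED and NOT PROVED; spine PROVED 0∕9; rung (B)+1 on a FINITE torus T⁴ — NOT
infinite volume, NOT the mass gap, NOT Clay. HONEST DEPENDENCY: continuum YM on T⁴ ⇐ BetaPertH ∧ nine spine estimates
(0/9 proved); BetaPertH ⇐ (D1) ∧ (D4) ∧ CAP+tail; G-an2-4 gates asym, D1 and NE2/3/4. POLICY: crux-route work under
`Spine/NE7b/` (offered by name in ROUTES v5 §3), not a `T4Continuum/Support` leaf (FREEZE (0) respected); one concrete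
definition (`distSq`), no `Prop`-valued fact, no `[cite:]` fact.
-/

set_option autoImplicit false

noncomputable section

namespace Summit.QuantumFields.BalabanUV.T4Continuum.NE7b.LatticeSubsolutionBarrier

open Finset
open scoped BigOperators
open Literature.Probability.LatticeModels (Site)
open Summit.QuantumFields.BalabanUV.T4Continuum.NE7b.AbelianCurvatureMaximumPrinciple (e layer mem_layer_of_not_mem
  e_ne_zero)

variable {d : ℕ}

/-! ## §1 The quadratic barrier `|x − x₀|²` and its lattice Laplacian -/

/-- Squared Euclidean lattice distance `|x − x₀|² = Σ_λ (x_λ − x₀_λ)²` (as a real number). -/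
def distSq (x₀ x : Site d) : ℝ := ∑ l : Fin d, (((x l - x₀ l : ℤ)) : ℝ) ^ 2

/-- `|x − x₀|² ≥ 0`. -/
theorem distSq_nonneg (x₀ x : Site d) : 0 ≤ distSq x₀ x :=
  Finset.sum_nonneg fun _ _ => sq_nonneg _

/-- `|x₀ − x₀|² = 0`. -/
theorem distSq_self (x₀ : Site d) : distSq x₀ x₀ = 0 := by
  simp [distSq]

/-- One forward step changes the barrier by `2(x_λ − x₀_λ) + 1`. -/
theorem distSq_add_e (x₀ x : Site d) (l : Fin d) :
    distSq x₀ (x + e l) = distSq x₀ x + 2 * ((x l - x₀ l : ℤ) : ℝ) + 1 := by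
  have h : distSq x₀ (x + e l) - distSq x₀ x = 2 * ((x l - x₀ l : ℤ) : ℝ) + 1 := by
    unfold distSq
    rw [← Finset.sum_sub_distrib, Finset.sum_eq_single l]
    · simp [e]; ring
    · intro l' _ hl'
      simp [e, hl']
    · intro h; exact absurd (Finset.mem_univ l) h
  linarith

/-- One backward step changes the barrier by `−2(x_λ − x₀_λ) + 1`. -/
theorem distSq_sub_e (x₀ x : Site d) (l : Fin d) :
    distSq x₀ (x - e l) = distSq x₀ x - 2 * ((x l - x₀ l : ℤ) : ℝ) + 1 := by
  have h : distSq x₀ (x - e l) - distSq x₀ x = -2 * ((x l - x₀ l : ℤ) : ℝ) + 1 := by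
    unfold distSq
    rw [← Finset.sum_sub_distrib, Finset.sum_eq_single l]
    · simp [e]; ring
    · intro l' _ hl'
      simp [e, hl']
    · intro h; exact absurd (Finset.mem_univ l) h
  linarith

/-- **`Δ|x − x₀|² = 2d` exactly**: `Σ_λ (|x+e_λ−x₀|² + |x−e_λ−x₀|²) = 2d·|x−x₀|² + 2d`. -/
theorem laplacian_distSq (x₀ x : Site d) :
    ∑ l : Fin d, (distSq x₀ (x + e l) + distSq x₀ (x - e l)) = 2 * (d : ℝ) * distSq x₀ x + 2 * (d : ℝ) := by
  rw [Finset.sum_congr rfl fun l _ => show distSq x₀ (x + e l) + distSq x₀ (x - e l) = 2 * distSq x₀ x + 2 by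
    rw [distSq_add_e, distSq_sub_e]; ring]
  rw [Finset.sum_const, Finset.card_univ, Fintype.card_fin, nsmul_eq_mul]
  ring

/-! ## §2 The maximum principle for lattice subharmonic functions -/

/-- At a maximum point of `I ∪ layer I` lying in `I`, a lattice SUBharmonic function is constant on the neighbours. -/
theorem eq_of_subharmonic_max {f : Site d → ℝ} {I : Finset (Site d)} {x : Site d} {M : ℝ} (hx : x ∈ I)
    (hsub : 2 * (d : ℝ) * f x ≤ ∑ l : Fin d, (f (x + e l) + f (x - e l)))
    (hmax : ∀ y ∈ I ∪ layer I, f y ≤ M) (hfx : f x = M) (l : Fin d) : f (x + e l) = M ∧ f (x - e l) = M := by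
  have hnb : ∀ l' : Fin d, f (x + e l') ≤ M ∧ f (x - e l') ≤ M := by
    intro l'
    obtain ⟨hp, hm⟩ := mem_layer_of_not_mem hx l'
    constructor
    · by_cases h : x + e l' ∈ I
      · exact hmax _ (mem_union_left _ h)
      · exact hmax _ (mem_union_right _ (hp h))
    · by_cases h : x - e l' ∈ I
      · exact hmax _ (mem_union_left _ h)
      · exact hmax _ (mem_union_right _ (hm h))
  have hsum : ∑ l' : Fin d, (f (x + e l') + f (x - e l')) = ∑ _l' : Fin d, (M + M) := by
    apply le_antisymm (Finset.sum_le_sum fun l' _ => add_le_add (hnb l').1 (hnb l').2)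
    have hc : ∑ _l' : Fin d, (M + M) = 2 * (d : ℝ) * M := by
      rw [Finset.sum_const, Finset.card_univ, Fintype.card_fin, nsmul_eq_mul]; ring
    rw [hc, ← hfx]; exact hsub
  have hall := (Finset.sum_eq_sum_iff_of_le fun l' _ => add_le_add (hnb l').1 (hnb l').2).1 hsum l (mem_univ l)
  constructor <;> linarith [(hnb l).1, (hnb l).2]

/-- **Maximum principle for lattice SUBharmonic functions.** Let `d ≥ 1`, `I` finite and
`2d·f(x) ≤ Σ_λ (f(x+e_λ) + f(x−e_λ))` for every `x ∈ I`. Then every value of `f` on `I` is bounded by a value on `layer I`. -/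
theorem exists_mem_layer_le_of_subharmonic (hd : 0 < d) {f : Site d → ℝ} {I : Finset (Site d)}
    (hsub : ∀ x ∈ I, 2 * (d : ℝ) * f x ≤ ∑ l : Fin d, (f (x + e l) + f (x - e l))) {x : Site d} (hx : x ∈ I) :
    ∃ y ∈ layer I, f x ≤ f y := by
  classical
  obtain ⟨z, hz, hzmax⟩ := Finset.exists_max_image (I ∪ layer I) f ⟨x, mem_union_left _ hx⟩
  rcases mem_union.1 hz with hzI | hzL
  swap
  · exact ⟨z, hzL, hzmax x (mem_union_left _ hx)⟩
  set l₀ : Fin d := ⟨0, hd⟩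
  let w : ℕ → Site d := fun n => z + (n : ℤ) • e l₀
  have hw0 : w 0 = z := by simp [w]
  have hwsucc : ∀ n, w (n + 1) = w n + e l₀ := by
    intro n; simp only [w]; push_cast; rw [add_smul, one_smul, add_assoc]
  have hinj : Function.Injective w := by
    intro m n hmn
    have h : ((m : ℤ) - n) • e l₀ = 0 := by
      have h' : (m : ℤ) • e l₀ = (n : ℤ) • e l₀ := add_left_cancel hmn
      rw [sub_smul, h', sub_self]
    rcases smul_eq_zero.1 h with h | h
    · exact_mod_cast sub_eq_zero.1 h
    · exact absurd h (e_ne_zero l₀)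
  have hex : ∃ n, w n ∉ I := by
    by_contra hall
    push Not at hall
    have hfin : (Set.range w).Finite := I.finite_toSet.subset (by rintro _ ⟨n, rfl⟩; exact hall n)
    exact Set.infinite_range_of_injective hinj hfin
  let n₀ := Nat.find hex
  have hn₀ : w n₀ ∉ I := Nat.find_spec hex
  have hpos : 0 < n₀ := by
    rw [Nat.pos_iff_ne_zero]; intro h0
    apply hn₀
    have : w n₀ = z := by simp only [n₀] at h0 ⊢; rw [h0, hw0]
    rw [this]; exact hzI
  have hval : ∀ n, n < n₀ → w n ∈ I ∧ f (w n) = f z := by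
    intro n
    induction n with
    | zero => intro _; exact ⟨by rw [hw0]; exact hzI, by rw [hw0]⟩
    | succ k ih =>
      intro hk
      have hkI : w (k + 1) ∈ I := by
        by_contra hc; exact Nat.find_min hex hk hc
      obtain ⟨hkI', hfk⟩ := ih (Nat.lt_of_succ_lt hk)
      refine ⟨hkI, ?_⟩
      rw [hwsucc]
      exact (eq_of_subharmonic_max hkI' (hsub _ hkI') hzmax hfk l₀).1
  obtain ⟨m, hm⟩ : ∃ m, n₀ = m + 1 := Nat.exists_eq_succ_of_ne_zero hpos.ne'
  obtain ⟨hmI, hfm⟩ := hval m (by omega)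
  have hmsucc : w (m + 1) ∉ I := by rw [← hm]; exact hn₀
  have hlayer : w (m + 1) ∈ layer I := by
    rw [hwsucc]; exact (mem_layer_of_not_mem hmI l₀).1 (by rw [← hwsucc]; exact hmsucc)
  have hfn : f (w (m + 1)) = f z := by
    rw [hwsucc]; exact (eq_of_subharmonic_max hmI (hsub _ hmI) hzmax hfm l₀).1
  exact ⟨w (m + 1), hlayer, by rw [hfn]; exact hzmax x (mem_union_left _ hx)⟩

/-! ## §3 The barrier lemma -/

/-- **THE BARRIER LEMMA FOR LATTICE SUBSOLUTIONS (ROUTES-NE7b v5 PH-k (γ) ∕ (T-k1)).** Let `d ≥ 1`, `I` finite and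
`2d·s(x) ≤ Σ_{λ,±} s(x ± e_λ) + κ` for every `x ∈ I` (any real `κ`). Then for every `x₀ ∈ I` there is `y ∈ layer I` with
`s(x₀) ≤ s(y) + (κ∕2d)·|y − x₀|²`: the function `w := s + (κ∕2d)|· − x₀|²` is lattice-subharmonic on `I` because
`Δ|x − x₀|² = 2d`, and `w(x₀) = s(x₀)`. -/
theorem barrier_subsolution (hd : 0 < d) {s : Site d → ℝ} {I : Finset (Site d)} {κ : ℝ}
    (hsub : ∀ x ∈ I, 2 * (d : ℝ) * s x ≤ ∑ l : Fin d, (s (x + e l) + s (x - e l)) + κ) {x₀ : Site d}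
    (hx₀ : x₀ ∈ I) : ∃ y ∈ layer I, s x₀ ≤ s y + κ / (2 * d) * distSq x₀ y := by
  have hd' : (0 : ℝ) < 2 * (d : ℝ) := by positivity
  set w : Site d → ℝ := fun x => s x + κ / (2 * d) * distSq x₀ x with hw
  have hwsub : ∀ x ∈ I, 2 * (d : ℝ) * w x ≤ ∑ l : Fin d, (w (x + e l) + w (x - e l)) := by
    intro x hx
    have h1 := hsub x hx
    have h2 := laplacian_distSq x₀ x
    have hsplit : ∑ l : Fin d, (w (x + e l) + w (x - e l)) =
        ∑ l : Fin d, (s (x + e l) + s (x - e l)) + κ / (2 * d) * ∑ l : Fin d, (distSq x₀ (x + e l) + distSq x₀ (x - e l)) := by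
      rw [Finset.mul_sum, ← Finset.sum_add_distrib]
      exact Finset.sum_congr rfl fun l _ => by simp only [hw]; ring
    rw [hsplit, h2]
    have hk : κ / (2 * d) * (2 * (d : ℝ) * distSq x₀ x + 2 * d) = κ * distSq x₀ x + κ := by
      field_simp
    rw [hk]
    have : 2 * (d : ℝ) * w x = 2 * d * s x + κ * distSq x₀ x := by
      simp only [hw]; field_simp
    rw [this]
    linarith
  obtain ⟨y, hy, hle⟩ := exists_mem_layer_le_of_subharmonic hd hwsub hx₀
  refine ⟨y, hy, ?_⟩
  have hw0 : w x₀ = s x₀ := by simp only [hw, distSq_self, mul_zero, add_zero]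
  rw [← hw0]
  exact hle

/-- **THE BARRIER LEMMA, NET FORM**: with `κ ≥ 0`, `s ≤ M` on the layer and the layer within squared distance `D²` of `x₀`,
`s(x₀) ≤ M + (κ∕2d)·D²` («the overshoot is governed by the DEPTH of `x₀` in `I`»). -/
theorem barrier_subsolution_le (hd : 0 < d) {s : Site d → ℝ} {I : Finset (Site d)} {κ M D2 : ℝ} (hκ : 0 ≤ κ)
    (hsub : ∀ x ∈ I, 2 * (d : ℝ) * s x ≤ ∑ l : Fin d, (s (x + e l) + s (x - e l)) + κ) {x₀ : Site d}
    (hx₀ : x₀ ∈ I) (hM : ∀ y ∈ layer I, s y ≤ M) (hD : ∀ y ∈ layer I, distSq x₀ y ≤ D2) :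
    s x₀ ≤ M + κ / (2 * d) * D2 := by
  obtain ⟨y, hy, hle⟩ := barrier_subsolution hd hsub hx₀
  have hk : 0 ≤ κ / (2 * d) := by positivity
  calc s x₀ ≤ s y + κ / (2 * d) * distSq x₀ y := hle
    _ ≤ M + κ / (2 * d) * D2 := add_le_add (hM y hy) (mul_le_mul_of_nonneg_left (hD y hy) hk)

/-- **THE BARRIER LEMMA WITH AN `x`-DEPENDENT SOURCE** (the shape of PH-k (β₄): `2d·s_p ≤ Σ s_{p±e_λ} + C′_d·m_p²`): if
`2d·s(x) ≤ Σ_{λ,±} s(x ± e_λ) + g(x)` with `g ≤ κ` on `I`, `κ ≥ 0`, then `s(x₀) ≤ max-on-layer + (κ∕2d)·D²` as above. -/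
theorem barrier_subsolution_le_of_source (hd : 0 < d) {s g : Site d → ℝ} {I : Finset (Site d)} {κ M D2 : ℝ}
    (hκ : 0 ≤ κ) (hsub : ∀ x ∈ I, 2 * (d : ℝ) * s x ≤ ∑ l : Fin d, (s (x + e l) + s (x - e l)) + g x)
    (hg : ∀ x ∈ I, g x ≤ κ) {x₀ : Site d} (hx₀ : x₀ ∈ I) (hM : ∀ y ∈ layer I, s y ≤ M)
    (hD : ∀ y ∈ layer I, distSq x₀ y ≤ D2) : s x₀ ≤ M + κ / (2 * d) * D2 :=
  barrier_subsolution_le hd hκ (fun x hx => (hsub x hx).trans (by linarith [hg x hx])) hx₀ hM hD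

/-! ## §4 The torsion barrier (ROUTES-NE7b v9 (T-k1τ), seat `t4-ne7b-idea-1` gen 9; appended by leaf-06 gen 29)

ROUTES-NE7b v9 «LOOK-IN LENGTH» notes that §3 consumes a CIRCUMRADIUS-type hypothesis (`hD`: `D²` bounds the squared
distance from `x₀` to EVERY point of `layer I`) and offers the variant that makes THIN domains cheap: replace the quadratic
barrier `|x − x₀|²` by any TORSION supersolution `u` (`−Δu ≥ 1` on `I`, `u ≥ 0` on the layer); for a slab of half-width `a`
in one coordinate, `u(x) = (a² − (x_λ − c)²)∕2` is an exact torsion solution and the overshoot becomes `κ·a²∕2`, free of the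
other dimensions. Law-free lattice potential theory; PRICING-NE7b v10 prices (T-k1τ) as an unfunded rider of a
KILL-CANDIDATE route — it is typed here as route-independent anatomy of the maximum principle, nothing more. -/

/-- **(T-k1τ) THE TORSION BARRIER.** `d ≥ 1`, `I` finite, `κ ≥ 0`; if `2d·s(x) ≤ Σ_{λ,±} s(x ± e_λ) + κ` on `I`
(the subsolution shape of §3), `u` satisfies `Σ_{λ,±} u(x ± e_λ) + 1 ≤ 2d·u(x)` on `I` (a torsion SUPERSOLUTION), `u ≥ 0` and
`s ≤ M` on `layer I`, then `s(x₀) ≤ M + κ·u(x₀)` for every `x₀ ∈ I` (`w := s − κu` is lattice-subharmonic on `I`;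
`exists_mem_layer_le_of_subharmonic`). -/
theorem torsion_barrier_le (hd : 0 < d) {s u : Site d → ℝ} {I : Finset (Site d)} {κ M : ℝ} (hκ : 0 ≤ κ)
    (hsub : ∀ x ∈ I, 2 * (d : ℝ) * s x ≤ ∑ l : Fin d, (s (x + e l) + s (x - e l)) + κ)
    (hu : ∀ x ∈ I, ∑ l : Fin d, (u (x + e l) + u (x - e l)) + 1 ≤ 2 * (d : ℝ) * u x)
    (hu0 : ∀ y ∈ layer I, 0 ≤ u y) (hM : ∀ y ∈ layer I, s y ≤ M) {x₀ : Site d} (hx₀ : x₀ ∈ I) :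
    s x₀ ≤ M + κ * u x₀ := by
  set w : Site d → ℝ := fun x => s x - κ * u x with hw
  have hwsub : ∀ x ∈ I, 2 * (d : ℝ) * w x ≤ ∑ l : Fin d, (w (x + e l) + w (x - e l)) := by
    intro x hx
    have h1 := hsub x hx
    have h2 := mul_le_mul_of_nonneg_left (hu x hx) hκ
    have hsum : ∑ l : Fin d, (w (x + e l) + w (x - e l)) =
        ∑ l : Fin d, (s (x + e l) + s (x - e l)) - κ * ∑ l : Fin d, (u (x + e l) + u (x - e l)) := by
      rw [Finset.mul_sum, ← Finset.sum_sub_distrib]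
      exact Finset.sum_congr rfl fun l _ => by simp only [hw]; ring
    rw [hsum]
    simp only [hw]
    nlinarith
  obtain ⟨y, hy, hle⟩ := exists_mem_layer_le_of_subharmonic hd hwsub hx₀
  have h3 : 0 ≤ κ * u y := mul_nonneg hκ (hu0 y hy)
  have h4 := hM y hy
  simp only [hw] at hle
  linarith

/-- **THE SLAB TORSION FUNCTION IS EXACT**: for `u(x) = (a² − (x_λ − c)²)∕2`,
`Σ_{μ,±} u(x ± e_μ) + 1 = 2d·u(x)` on all of `ℤ^d` (second difference `−1` in direction `λ`, `0` in the others). -/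
theorem slab_torsion_eq (lam : Fin d) (a c : ℝ) (x : Site d) :
    ∑ l : Fin d, ((a ^ 2 - (((x + e l) lam : ℝ) - c) ^ 2) / 2 + (a ^ 2 - (((x - e l) lam : ℝ) - c) ^ 2) / 2) + 1 =
      2 * (d : ℝ) * ((a ^ 2 - ((x lam : ℝ) - c) ^ 2) / 2) := by
  have hterm : ∀ l : Fin d, (a ^ 2 - (((x + e l) lam : ℝ) - c) ^ 2) / 2 + (a ^ 2 - (((x - e l) lam : ℝ) - c) ^ 2) / 2 =
      (a ^ 2 - ((x lam : ℝ) - c) ^ 2) - (if lam = l then (1 : ℝ) else 0) := by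
    intro l
    by_cases h : lam = l
    · subst h
      simp only [Pi.add_apply, Pi.sub_apply, e, Pi.single_eq_same, Int.cast_add, Int.cast_sub, Int.cast_one, if_true]
      ring
    · simp only [Pi.add_apply, Pi.sub_apply, e, Pi.single_eq_of_ne h, add_zero, sub_zero, if_neg h]
      ring
  rw [Finset.sum_congr rfl fun l _ => hterm l, Finset.sum_sub_distrib, Finset.sum_const, Finset.card_univ,
    Fintype.card_fin, nsmul_eq_mul, Finset.sum_ite_eq Finset.univ lam, if_pos (Finset.mem_univ _)]
  ring

/-- **THE THIN-SLAB BARRIER** (v9's instance of (T-k1τ)): if the layer of `I` lies in the slab `|y_λ − c| ≤ a` (so the slab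
torsion function is `≥ 0` there) then a subsolution with defect `κ` exceeds its layer maximum by at most `κ·a²∕2`, whatever
the extent of `I` in the other directions. -/
theorem slab_barrier_le (hd : 0 < d) {s : Site d → ℝ} {I : Finset (Site d)} {κ M a c : ℝ} (hκ : 0 ≤ κ) (lam : Fin d)
    (hsub : ∀ x ∈ I, 2 * (d : ℝ) * s x ≤ ∑ l : Fin d, (s (x + e l) + s (x - e l)) + κ)
    (hslab : ∀ y ∈ layer I, ((y lam : ℝ) - c) ^ 2 ≤ a ^ 2) (hM : ∀ y ∈ layer I, s y ≤ M) {x₀ : Site d} (hx₀ : x₀ ∈ I) :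
    s x₀ ≤ M + κ * (a ^ 2 / 2) := by
  have h := torsion_barrier_le hd (u := fun x => (a ^ 2 - ((x lam : ℝ) - c) ^ 2) / 2) hκ hsub
    (fun x _ => (slab_torsion_eq lam a c x).le)
    (fun y hy => show 0 ≤ (a ^ 2 - ((y lam : ℝ) - c) ^ 2) / 2 by have := hslab y hy; linarith) hM hx₀
  have h2 : κ * ((a ^ 2 - ((x₀ lam : ℝ) - c) ^ 2) / 2) ≤ κ * (a ^ 2 / 2) :=
    mul_le_mul_of_nonneg_left (by nlinarith [sq_nonneg ((x₀ lam : ℝ) - c)]) hκ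
  exact h.trans (by linarith)

end Summit.QuantumFields.BalabanUV.T4Continuum.NE7b.LatticeSubsolutionBarrier
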